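import Literature.AnabelianGeometry.AbsoluteAnabelian.GaloisCyclotomeOpenSubgroupAction
import HarnessLib

/-!
# `μ_Ẑ(H) ≅ μ_Ẑ(G)` (open subgroup) is NATURAL in compatible pairs of isomorphisms of topological groups

Mochizuki, *Topics in Absolute Anabelian Geometry III*, §1, Cor. 1.10 (i)(a), manuscript p. 42: "the underlying
module of `μ_{ℚ/ℤ}(G_k)`, `μ_Ẑ(G_k)` is unaffected by the operation of passing from `G_k` to an open subgroup" — a
"functorial group-theoretic algorithm" [cite: MochizukiAbsTopIII2015, Cor 1.10 (i) p.42]; [AbsAnab] Prop. 1.2.1 (vi)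
p. 10. abc-iut cell (layer L4 vocabulary; seat abc-iut-w5-d145 gen 4, support chain «CW5D145-CONSOLIDATE» piece P1 for
GAP-LEDGER G-w5d145-2). PROOF-ONLY, no definition, Mathlib + the tree's L4 cyclotome files only.

abc-iut-L4-t1's comparison `muQZ.restrictOpen H : μ_{ℚ/ℤ}(H) → μ_{ℚ/ℤ}(G)` / `muZhat.restrictOpenEquiv H :
μ_Ẑ(H) ⥲ μ_Ẑ(G)` (`GaloisCyclotomeOpenSubgroup`) was proved `H`-equivariant (`muQZ.restrictOpen_smul`, i.e. natural
for the INNER automorphisms `conj_h`, `h ∈ H`; `GaloisCyclotomeOpenSubgroupAction`, abc-iut-w5-d145 gen 3). THIS FILE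
proves the general naturality: for compact groups `G, G'`, open subgroups `H ≤ G`, `H' ≤ G'`, an isomorphism of
topological groups `φ : G ⥲ G'` and an isomorphism `ψ : H ⥲ H'` COMPATIBLE with it (`(ψ h : G') = φ h`),

  `restrictOpen H' ∘ μ_{ℚ/ℤ}(ψ) = μ_{ℚ/ℤ}(φ) ∘ restrictOpen H`      (`muQZ.restrictOpen_map_of_compat`),
  `restrictOpenEquiv H' ∘ μ_Ẑ(ψ) = μ_Ẑ(φ) ∘ restrictOpenEquiv H`    (`muZhat.restrictOpenEquiv_congr_of_compat`),

e.g. `φ = conj_τ` on `G_{ℚ_p}` for `τ` NORMALISING `G_K` and `ψ = conj_τ|_{G_K}` (an OUTER automorphism of `G_K` in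
general): the open-subgroup invariance of the group-theoretic cyclotome commutes with every automorphism of the pair
`(G ⊇ H)`. Proof: on representatives `[u ∈ U']` (`muQZ.ofRep`), both sides are the class of `φ u` in the open subgroup
`φ(U'†) = ψ(U')†` of `G'` (`osMap_imageOpenSubgroup_of_compat`). Classical; nothing here bears on [IUTchIII] Cor. 3.12.
-/

noncomputable section

universe u

namespace Literature.AnabelianGeometry.AbsoluteAnabelian

variable {G : Type u} [Group G] [TopologicalSpace G] [IsTopologicalGroup G] [CompactSpace G]
  {G' : Type u} [Group G'] [TopologicalSpace G'] [IsTopologicalGroup G'] [CompactSpace G']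
  (H : OpenSubgroup G) (H' : OpenSubgroup G') (φ : G ≃ₜ* G')
  (ψ : (H : Subgroup G) ≃ₜ* (H' : Subgroup G')) (hψ : ∀ h : (H : Subgroup G), ((ψ h : (H' : Subgroup G')) : G') = φ h)

omit [IsTopologicalGroup G] [CompactSpace G] [IsTopologicalGroup G'] [CompactSpace G'] in
include hψ in
/-- A compatible pair `(φ, ψ)` satisfies `φ(H) = H'`: `φ g ∈ H' ↔ g ∈ H`. [cite: MochizukiAbsTopIII2015, Cor 1.10 (i) p.42] -/
theorem apply_mem_iff_of_compat (g : G) : φ g ∈ H' ↔ g ∈ H := by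
  constructor
  · intro hg
    -- `φ g = ψ (ψ⁻¹ ⟨φ g, hg⟩) = φ (ψ⁻¹ ⟨φ g, hg⟩)`, so `g = ψ⁻¹ ⟨φ g, hg⟩ ∈ H`
    have h1 : φ g = φ ((ψ.symm ⟨φ g, hg⟩ : (H : Subgroup G)) : G) := by
      rw [← hψ, ContinuousMulEquiv.apply_symm_apply]
    rw [φ.injective h1]
    exact SetLike.coe_mem _
  · intro hg
    rw [← hψ ⟨g, hg⟩]
    exact SetLike.coe_mem _

omit [IsTopologicalGroup G] [CompactSpace G] [IsTopologicalGroup G'] [CompactSpace G'] in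
include hψ in
/-- **`ψ(U')† = φ(U'†)`**: for an open subgroup `U'` of `H`, the image in `G'` of `ψ(U') ≤ H'` is the image under `φ` of
the image `U'† ≤ G` of `U'`. [cite: MochizukiAbsTopIII2015, Cor 1.10 (i) p.42] -/
theorem osMap_imageOpenSubgroup_of_compat (U' : OpenSubgroup (H : Subgroup G)) :
    osMap H' (imageOpenSubgroup ψ U') = imageOpenSubgroup φ (osMap H U') := by
  ext g'
  rw [mem_osMap_iff]
  change (∃ hg' : g' ∈ H', ψ.symm ⟨g', hg'⟩ ∈ U') ↔ φ.symm g' ∈ osMap H U'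
  rw [mem_osMap_iff]
  -- the underlying element of `ψ⁻¹ ⟨g', _⟩` is `φ⁻¹ g'`
  have hval : ∀ hg' : g' ∈ H', ((ψ.symm ⟨g', hg'⟩ : (H : Subgroup G)) : G) = φ.symm g' := fun hg' => by
    apply φ.injective
    rw [← hψ, ContinuousMulEquiv.apply_symm_apply, ContinuousMulEquiv.apply_symm_apply]
  constructor
  · rintro ⟨hg', hU⟩
    refine ⟨by rw [← hval hg']; exact SetLike.coe_mem _, ?_⟩
    convert hU using 1
    exact Subtype.ext (hval hg').symm
  · rintro ⟨hg, hU⟩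
    have hg' : g' ∈ H' := by
      have := (apply_mem_iff_of_compat H H' φ ψ hψ (φ.symm g')).2 hg
      rwa [ContinuousMulEquiv.apply_symm_apply] at this
    refine ⟨hg', ?_⟩
    convert hU using 1
    exact Subtype.ext (hval hg')

open scoped Classical in
include hψ in
/-- **Naturality of `μ_{ℚ/ℤ}(H) → μ_{ℚ/ℤ}(G)` in compatible pairs of isomorphisms**: `restrictOpen H' (μ_{ℚ/ℤ}(ψ) z) =
μ_{ℚ/ℤ}(φ) (restrictOpen H z)`. On a representative `[u ∈ U']` both sides are `[φ u ∈ φ(U'†)]`.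
[cite: MochizukiAbsTopIII2015, Cor 1.10 (i) p.42] -/
theorem muQZ.restrictOpen_map_of_compat (z : muQZ (H : Subgroup G)) :
    muQZ.restrictOpen H' (muQZ.map ψ z) = muQZ.map φ (muQZ.restrictOpen H z) := by
  obtain ⟨U', u, hu, ht, rfl⟩ := muQZ.exists_ofRep z
  rw [muQZ.map_ofRep, muQZ.restrictOpen_ofRep, muQZ.restrictOpen_ofRep, muQZ.map_ofRep]
  exact muQZ.ofRep_congr (osMap_imageOpenSubgroup_of_compat H H' φ ψ hψ U') (hψ u)

open scoped Classical in
include hψ in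
/-- The same for the comparison ISOMORPHISM `μ_{ℚ/ℤ}(H) ≃+ μ_{ℚ/ℤ}(G)`. [cite: MochizukiAbsTopIII2015, Cor 1.10 (i) p.42] -/
theorem muQZ.restrictOpenEquiv_map_of_compat (z : muQZ (H : Subgroup G)) :
    muQZ.restrictOpenEquiv H' (muQZ.map ψ z) = muQZ.map φ (muQZ.restrictOpenEquiv H z) := by
  rw [muQZ.restrictOpenEquiv_apply, muQZ.restrictOpenEquiv_apply, muQZ.restrictOpen_map_of_compat H H' φ ψ hψ]

open scoped Classical in
include hψ in
/-- And for its inverse: `(restrictOpenEquiv H')⁻¹ (μ_{ℚ/ℤ}(φ) z) = μ_{ℚ/ℤ}(ψ) ((restrictOpenEquiv H)⁻¹ z)`.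
[cite: MochizukiAbsTopIII2015, Cor 1.10 (i) p.42] -/
theorem muQZ.restrictOpenEquiv_symm_map_of_compat (z : muQZ G) :
    (muQZ.restrictOpenEquiv H').symm (muQZ.map φ z) = muQZ.map ψ ((muQZ.restrictOpenEquiv H).symm z) := by
  apply (muQZ.restrictOpenEquiv H').injective
  rw [AddEquiv.apply_symm_apply, muQZ.restrictOpenEquiv_map_of_compat H H' φ ψ hψ, AddEquiv.apply_symm_apply]

open scoped Classical in
include hψ in
/-- **Naturality of `μ_Ẑ(H) ⥲ μ_Ẑ(G)` in compatible pairs of isomorphisms** ([AbsTopIII] Cor. 1.10 (i)(a): the open-subgroup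
invariance of the group-theoretic cyclotome is functorial): `restrictOpenEquiv H' (μ_Ẑ(ψ) ζ) = μ_Ẑ(φ) (restrictOpenEquiv H ζ)`.
[cite: MochizukiAbsTopIII2015, Cor 1.10 (i) p.42] -/
theorem muZhat.restrictOpenEquiv_congr_of_compat (ζ : muZhat (H : Subgroup G)) :
    muZhat.restrictOpenEquiv H' (muZhat.congr ψ ζ) = muZhat.congr φ (muZhat.restrictOpenEquiv H ζ) := by
  refine Subtype.ext (funext fun n => ?_)
  rw [muZhat.coe_restrictOpenEquiv_apply, muZhat.coe_congr, muZhat.coe_congr, muZhat.map_apply_coe,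
    muZhat.map_apply_coe, muZhat.coe_restrictOpenEquiv_apply, toAdd_ofAdd, toAdd_ofAdd,
    muQZ.restrictOpen_map_of_compat H H' φ ψ hψ]

open scoped Classical in
include hψ in
/-- And for its inverse `μ_Ẑ(G) ⥲ μ_Ẑ(H)`. [cite: MochizukiAbsTopIII2015, Cor 1.10 (i) p.42] -/
theorem muZhat.restrictOpenEquiv_symm_congr_of_compat (ξ : muZhat G) :
    (muZhat.restrictOpenEquiv H').symm (muZhat.congr φ ξ) = muZhat.congr ψ ((muZhat.restrictOpenEquiv H).symm ξ) := by
  apply (muZhat.restrictOpenEquiv H').injective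
  rw [MulEquiv.apply_symm_apply, muZhat.restrictOpenEquiv_congr_of_compat H H' φ ψ hψ, MulEquiv.apply_symm_apply]

end Literature.AnabelianGeometry.AbsoluteAnabelian

end
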